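import Literature.AnabelianGeometry.EtaleTheta.Discharge.Sec5Prop52AtThetaSetting

/-!
# [EtTh] Prop. 5.2 (ii) p.324 (PDF p.98; kurims-ms p.89) AT THE §1-DEFINING READING: the section-defined actions EXIST UNIQUELY in `C` and ARE the bi-Kummer actions

Mochizuki, *The étale theta function and its Frobenioid-theoretic manifestations*, Publ. RIMS **45** (2009), Prop. 5.2 (ii)
p.324 (PDF p.98): "The group actions of Proposition 1.1, (ii); Lemma 1.2, arising from '`s_{l·N}`', '`τ_{l·N}`', respectively, are
precisely the actions determined by the bi-Kummer `l·N`-th root [cf. Proposition 4.3, (i)] arising from the `l·N`-th root of (i)."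
Printed proof (p.324): "These assertions follow immediately from the definitions."
[cite: MochizukiEtTh2009, Prop 5.2 (ii) p.324 (PDF p.98)]

abc-iut cell, layer L2 = [EtTh], seat abc-iut-L2-t4 (gen 7; the §5 typer lineage of record), cone row `EtTh:Prop5.2(ii)` (kernel DAG
alias `N_EtTh_Prop5_2_ii`).  PROOF-ONLY end-knit over this lineage's FROZEN trunk `FrobenioidThetaBiKummer.lean` (p406884) and the
discharge files of abc-iut-f-126 (`Sec5Prop52InstanceForms`, `Sec5Prop52AtGenuineBases`, `Sec5Prop52AtThetaSetting`) and
abc-iut-w6-d086 (`Sec5Prop52iiOfConnectedTemperoid`): no `def`, no `Prop`-valued definition, no instance, no notation; nothing landed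
is edited or restated; every input is a constructor argument of the data or a theorem cited BY NAME.

THE READING.  Both sides of Prop. 5.2 (ii) are DEFINED in print by one and the same universal property:
* §1 side — Prop. 1.1 (ii) p.241 (PDF p.15): "There is a unique action of `Π^tp_X` on `L_N ⊗ O_{J_N}` … that is compatible with the
  morphism `Z_N → V(L_N ⊗ O_{J_N})` determined by `s_N`"; Lem. 1.2 p.245 (PDF p.19): "actions of `Π^tp_Y` (respectively, `Π^tp_Ÿ`) on
  `Ÿ_N`, `V(L̈_N)` which preserve `τ_N`" (abc-iut-L2-t1's `ThetaSetting.Prop11ii` — `∃ ρ, IsCompatibleWith ρ sN ∧ ∀ ρ', IsCompatibleWith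
  ρ' sN → ρ' = ρ` — and `ThetaSetting.Lem12` — `Preserves (ρ N g) (τ N)` — over the carrier-less automorphism groups `AutV`, `AutVdd`
  of `ThetaTrivializations.lean`; formal schemes have no carrier in the tree, plan/FOUNDATIONS.md row 14);
* §5 side — p.324: the pull-backs of `s_{l·N}`, `τ_{l·N}` "may be interpreted as morphisms `V(O_{Z̈_{l·N}}) → V(L̈_{l·N}|_{Z̈_{l·N}})` —
  i.e., as morphisms between objects of `C`", our `s^⊓_N, s^⊔_N : A_N → B_N`; p.331 (PDF p.105): `s^trv_N` "determines unique group
  homomorphisms" `s^⊓-gp_N`, `s^⊔-gp_N` by `s^⊓-gp_N(g) ∘ s^⊓_N = s^⊓_N ∘ s^trv_N(g′)`, `s^⊔-gp_N(h) ∘ s^⊔_N = s^⊔_N ∘ s^trv_N(h′)`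
  (this lineage's `SgpCapSpec`, `SgpCupSpec`, `SgpUnique`).
READ IN `C`, "the action of Prop. 1.1 (ii) arising from `s_{l·N}`" is therefore THE action of `H_{B_N}` on `B_N` compatible with the
morphism `s^⊓_N` determined by `s_{l·N}` (over the action `s^trv_N` on the trivial bundle `A_N`), and "the action of Lem. 1.2 arising from
`τ_{l·N}`" is THE action compatible with `s^⊔_N` ("preserves `τ_N`").  The typed row `FrobenioidThetaBiKummer.ThetaPairActionsAgree 𝔉
actS actT` (`actS = s^⊓-gp_N|_{H_{B_N}} ∧ actT = s^⊔-gp_N`) receives the two §1 actions as PARAMETERS (`TODO-merge(abc-iut-L2-t1)` in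
its docstring).  WHAT THE TREE HAD for the row: universal closure REFUTED, tautological instance PROVED (abc-iut-w6-d043,
`Sec5BiKummerSchemaVerdicts`); for parameters, `ThetaPairActionsAgree ⟺ the two defining relations` at the printed hypotheses
(abc-iut-f-126 `FrobenioidThetaBiKummer.thetaPairActionsAgree_iff_definingRelations`) and at every genuine carrier (abc-iut-w6-d086
`thetaPairActionsAgree_ofConnectedTemperoidData_iff`, abc-iut-f-126 `…_ofThetaSettingData(Q)_iff`, `…_ofTemperoidData_iff`, tower
levels); uniqueness `SgpUnique` at the genuine carriers (`Sec5SgpUniqueAtGenuineBases`, `Sec5SgpUniqueAtThetaSettingYdd`).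

WHAT IS PROVED HERE (the row with its parameters ELIMINATED by their printed definition — one closed sentence per carrier):
* generic, any §5 datum `𝔉` in a totally epimorphic `C` ([FrdI] Def. 1.3) whose `s^⊓-gp_N`, `s^⊔-gp_N` satisfy the p.331 relations:
  `existsUnique_fullAction_compatible_sCap_of_totallyEpi` (Prop. 1.1 (ii) read in `C`, FULL-GROUP form: the action of
  `Aut_D(B_N^bs) = Gal` — "factors through `Π^tp_X/Π^tp_{Z_N} = Gal(Z_N/X)`" — compatible with `s^⊓_N` EXISTS and is UNIQUE),
  `existsUnique_action_compatible_sCap_of_totallyEpi` (the same on `H_{B_N}`), `existsUnique_action_compatible_sCup_of_totallyEpi`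
  (Lem. 1.2 read in `C`: the `τ`-preserving action of `H_{B_N}` EXISTS and is UNIQUE), and the headline
  `thetaPairActionsAgree_sectionDefined_of_totallyEpi`:
  **`∃ actS actT`, (compatible with `s^⊓_N`, `s^⊔_N`) ∧ (UNIQUE such pair) ∧ `ThetaPairActionsAgree 𝔉 actS actT`** — the
  section-defined §1 actions exist uniquely in `C` and ARE the actions of the bi-Kummer root (converse direction — a pair satisfying
  the row is compatible — is abc-iut-f-126's `FrobenioidThetaBiKummer.definingRelations_of_thetaPairActionsAgree`, cited, not restated); `Facts` form
  `Facts.thetaPairActionsAgree_sectionDefined` over this lineage's bundle of §5 named inputs;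
* the headline at the GENUINE carriers, hypothesis list = the constructor data ONLY (total epimorphicity = [FrdI] Thm. 5.2 for the model
  Frobenioid, `epi_of_model`; the relations = this lineage's THEOREMS `sgpCapSpec_…` / `sgpCupSpec_…`):
  `thetaPairActionsAgree_sectionDefined_ofConnectedTemperoidData` (genuine connected base `B^temp(Π^tp_X)⁰`; the assembled data
  `ofBiKummerData` over any bi-Kummer setting and abc-iut-f-126's `ofTemperoidData` / tower levels follow by the same one-line application
  of the generic headline to `epi_of_model` and this lineage's `sgpCapSpec_…`/`sgpCupSpec_…` theorems there — not spelled out, to keep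
  the file ≤ 400 lines), `…_ofThetaSettingData` (the §5 data OF THE §1 SETTING,
  `X := Π^tp_X̲̲`, `T :=` abc-iut-L2-t8's `thetaEnvData`, any Frobenius-trivial Galois `A_⊙`, in particular `A_⊙^bs := Ÿ̲̲`),
  `…_ofThetaSettingDataQ` (the binder-census object of record: `(l·Δ_Θ)_(−)` pinned to abc-iut-L2-t9's `ThetaSubquotient.ofSettingSub`).
  No named fact, no GAP-LEDGER row, no `hH`, no section hypothesis.
WHAT IS NOT PROVED (honest): no homomorphism from abc-iut-L2-t1's carrier-less `AutV N` / `AutVdd N` to `Aut_C(B_N)` is constructed —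
none can be without a model of the geometric line bundles `V(L̈_N)` (FOUNDATIONS row 14); the identification "sections = morphisms of
`C`" of p.324 is print's DEFINITION of the §5 data, under which the §1 defining properties become the compatibility equations below.
HONEST FRAMING: kernel-checked consequences of the cell's typed statements for data so constructed; the parameter `tf` (Ex. 3.9 data) is
not shown inhabited for the curve; nothing of [EtTh] (a refereed paper) is asserted unconditionally; a FACT row is an assumption label,
not an endorsement; nothing here bears on [IUTchIII] Cor. 3.12; no side is taken; typed ≠ proved.
-/

noncomputable section

namespace Literature.AnabelianGeometry.EtaleTheta

open CategoryTheory Opposite Literature.AlgebraicGeometry.Frobenioids Literature.AnabelianGeometry.SemiGraphs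
  Literature.AnabelianGeometry.SemiGraphs.GaloisObjects Literature.AlgebraicGeometry.Frobenioids.QuasiTemperoid.BTempConnected
  FrobenioidThetaBiKummer

universe u₀ v₀ w v v' u u'

namespace ThetaFrobenioid

/-! ### Generic: any §5 datum in a totally epimorphic `C` with the p.331 defining relations -/

section Generic

variable {C : Type u} [Category.{v} C] {D : Type u'} [Category.{v'} D] (𝔉 : ThetaFrobenioid.{w} C D)

/-- **Prop. 1.1 (ii) read in `C`, full-group form** ("a unique action … compatible with the morphism … determined by `s_N`", which
"factors through `Π^tp_X/Π^tp_{Z_N} = Gal(Z_N/X)`", p.241 (PDF p.15); here `Gal = Aut_D(B_N^bs)`, Def. 4.1 (ii)): in a totally epimorphic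
`C` there is EXACTLY ONE homomorphism `a : Aut_D(B_N^bs) → Aut_C(B_N)` compatible with `s^⊓_N` over `s^trv_N`, namely `s^⊓-gp_N`
(existence = the p.331 defining relation `SgpCapSpec`; uniqueness = abc-iut-w6-d086's `eq_sgpCap_of_comp_eq`).
[cite: MochizukiEtTh2009, Prop 5.2 (ii) p.324 (PDF p.98); Prop 1.1 (ii) p.241 (PDF p.15); §5 p.331 (PDF p.105)] -/
theorem existsUnique_fullAction_compatible_sCap_of_totallyEpi (hepi : ∀ ⦃X Y : C⦄ (f : X ⟶ Y), Epi f)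
    (hcap : 𝔉.SgpCapSpec) :
    ∃! a : Aut (𝔉.base.obj 𝔉.BN) →* Aut 𝔉.BN,
      ∀ g : Aut (𝔉.base.obj 𝔉.BN), 𝔉.sCap ≫ (a g).hom = (𝔉.strv (𝔉.autBaseIsoAB.symm g)).hom ≫ 𝔉.sCap := by
  haveI : Epi 𝔉.sCap := hepi _
  exact ⟨𝔉.sgpCap, fun g => hcap g, fun a ha => eq_sgpCap_of_comp_eq 𝔉 hcap a ha⟩

/-- **Prop. 1.1 (ii) read in `C`, on `H_{B_N}`**: in a totally epimorphic `C` there is EXACTLY ONE action `H_{B_N} → Aut_C(B_N)` compatible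
with the morphism `s^⊓_N` determined by `s_{l·N}` (over `s^trv_N`), namely `s^⊓-gp_N|_{H_{B_N}}`.
[cite: MochizukiEtTh2009, Prop 5.2 (ii) p.324 (PDF p.98); Prop 1.1 (ii) p.241 (PDF p.15); §5 p.331 (PDF p.105)] -/
theorem existsUnique_action_compatible_sCap_of_totallyEpi (hepi : ∀ ⦃X Y : C⦄ (f : X ⟶ Y), Epi f)
    (hcap : 𝔉.SgpCapSpec) :
    ∃! a : 𝔉.HB →* Aut 𝔉.BN,
      ∀ h : 𝔉.HB, 𝔉.sCap ≫ (a h).hom = (𝔉.strv (𝔉.autBaseIsoAB.symm (h : Aut (𝔉.base.obj 𝔉.BN)))).hom ≫ 𝔉.sCap := by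
  haveI : Epi 𝔉.sCap := hepi _
  refine ⟨𝔉.sgpCap.comp 𝔉.HB.subtype, fun h => hcap h, fun a ha => ?_⟩
  ext h : 1
  apply Aut.ext
  exact (cancel_epi 𝔉.sCap).mp ((ha h).trans (hcap h).symm)

/-- **Lem. 1.2 read in `C`** ("actions of `Π^tp_Ÿ` on `Ÿ_N`, `V(L̈_N)` which preserve `τ_N`", p.245 (PDF p.19)): in a totally epimorphic
`C` there is EXACTLY ONE action `H_{B_N} → Aut_C(B_N)` compatible with the morphism `s^⊔_N` determined by `τ_{l·N}` (over `s^trv_N`),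
namely `s^⊔-gp_N` (existence = `SgpCupSpec`, p.331; uniqueness by cancelling the epimorphism `s^⊔_N`).
[cite: MochizukiEtTh2009, Prop 5.2 (ii) p.324 (PDF p.98); Lem 1.2 p.245 (PDF p.19); §5 p.331 (PDF p.105)] -/
theorem existsUnique_action_compatible_sCup_of_totallyEpi (hepi : ∀ ⦃X Y : C⦄ (f : X ⟶ Y), Epi f)
    (hcup : 𝔉.SgpCupSpec) :
    ∃! b : 𝔉.HB →* Aut 𝔉.BN,
      ∀ h : 𝔉.HB, 𝔉.sCup ≫ (b h).hom = (𝔉.strv (𝔉.autBaseIsoAB.symm (h : Aut (𝔉.base.obj 𝔉.BN)))).hom ≫ 𝔉.sCup := by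
  haveI : Epi 𝔉.sCup := hepi _
  refine ⟨𝔉.sgpCup, fun h => hcup h, fun b hb => ?_⟩
  ext h : 1
  apply Aut.ext
  exact (cancel_epi 𝔉.sCup).mp ((hb h).trans (hcup h).symm)

/-- **[EtTh] Prop. 5.2 (ii) at the §1-defining reading, generic headline**: in a totally epimorphic `C` ([FrdI] Def. 1.3) whose
`s^⊓-gp_N`, `s^⊔-gp_N` satisfy the p.331 defining relations, the §1 actions "arising from `s_{l·N}`, `τ_{l·N}`" — DEFINED (Prop. 1.1 (ii),
Lem. 1.2) as the actions compatible with the morphisms these sections determine, read in `C` as `s^⊓_N`, `s^⊔_N` — EXIST, are UNIQUE,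
and satisfy the typed row `ThetaPairActionsAgree`: they "are precisely the actions determined by the bi-Kummer root
[cf. Proposition 4.3, (i)]".  Print: "These assertions follow immediately from the definitions."
[cite: MochizukiEtTh2009, Prop 5.2 (ii) p.324 (PDF p.98); §5 p.331 (PDF p.105)] -/
theorem thetaPairActionsAgree_sectionDefined_of_totallyEpi (hepi : ∀ ⦃X Y : C⦄ (f : X ⟶ Y), Epi f)
    (hcap : 𝔉.SgpCapSpec) (hcup : 𝔉.SgpCupSpec) :
    ∃ actS actT : 𝔉.HB →* Aut 𝔉.BN,
      ((∀ h : 𝔉.HB, 𝔉.sCap ≫ (actS h).hom = (𝔉.strv (𝔉.autBaseIsoAB.symm (h : Aut (𝔉.base.obj 𝔉.BN)))).hom ≫ 𝔉.sCap) ∧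
        ∀ h : 𝔉.HB, 𝔉.sCup ≫ (actT h).hom = (𝔉.strv (𝔉.autBaseIsoAB.symm (h : Aut (𝔉.base.obj 𝔉.BN)))).hom ≫ 𝔉.sCup) ∧
      (∀ actS' actT' : 𝔉.HB →* Aut 𝔉.BN,
        (∀ h : 𝔉.HB, 𝔉.sCap ≫ (actS' h).hom = (𝔉.strv (𝔉.autBaseIsoAB.symm (h : Aut (𝔉.base.obj 𝔉.BN)))).hom ≫ 𝔉.sCap) →
        (∀ h : 𝔉.HB, 𝔉.sCup ≫ (actT' h).hom = (𝔉.strv (𝔉.autBaseIsoAB.symm (h : Aut (𝔉.base.obj 𝔉.BN)))).hom ≫ 𝔉.sCup) →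
          actS' = actS ∧ actT' = actT) ∧
      ThetaPairActionsAgree 𝔉 actS actT := by
  refine ⟨𝔉.sgpCap.comp 𝔉.HB.subtype, 𝔉.sgpCup, ⟨fun h => hcap h, fun h => hcup h⟩, fun actS' actT' hS hT => ?_, rfl, rfl⟩
  exact ⟨(existsUnique_action_compatible_sCap_of_totallyEpi 𝔉 hepi hcap).unique hS fun h => hcap h,
    (existsUnique_action_compatible_sCup_of_totallyEpi 𝔉 hepi hcup).unique hT fun h => hcup h⟩

/-- **`Facts` form of the headline** over this lineage's bundle `Facts` of §5 named inputs (fields `epi_sCap`, `epi_sCup`, `sgpCapSpec`,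
`sgpCupSpec`), for consumers that carry `Facts` BY NAME.  [cite: MochizukiEtTh2009, Prop 5.2 (ii) p.324 (PDF p.98); §5 p.331 (PDF p.105)] -/
theorem Facts.thetaPairActionsAgree_sectionDefined {𝔉 : ThetaFrobenioid.{w} C D} (H : 𝔉.Facts) :
    ∃ actS actT : 𝔉.HB →* Aut 𝔉.BN,
      ((∀ h : 𝔉.HB, 𝔉.sCap ≫ (actS h).hom = (𝔉.strv (𝔉.autBaseIsoAB.symm (h : Aut (𝔉.base.obj 𝔉.BN)))).hom ≫ 𝔉.sCap) ∧
        ∀ h : 𝔉.HB, 𝔉.sCup ≫ (actT h).hom = (𝔉.strv (𝔉.autBaseIsoAB.symm (h : Aut (𝔉.base.obj 𝔉.BN)))).hom ≫ 𝔉.sCup) ∧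
      (∀ actS' actT' : 𝔉.HB →* Aut 𝔉.BN,
        (∀ h : 𝔉.HB, 𝔉.sCap ≫ (actS' h).hom = (𝔉.strv (𝔉.autBaseIsoAB.symm (h : Aut (𝔉.base.obj 𝔉.BN)))).hom ≫ 𝔉.sCap) →
        (∀ h : 𝔉.HB, 𝔉.sCup ≫ (actT' h).hom = (𝔉.strv (𝔉.autBaseIsoAB.symm (h : Aut (𝔉.base.obj 𝔉.BN)))).hom ≫ 𝔉.sCup) →
          actS' = actS ∧ actT' = actT) ∧
      ThetaPairActionsAgree 𝔉 actS actT := by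
  refine ⟨𝔉.sgpCap.comp 𝔉.HB.subtype, 𝔉.sgpCup, ⟨fun h => H.sgpCapSpec h, fun h => H.sgpCupSpec h⟩,
    fun actS' actT' hS hT => ?_, rfl, rfl⟩
  exact ((H.thetaPairActionsAgree_iff_definingRelations actS' actT').2 ⟨hS, hT⟩)

end Generic

/-! ### The §5 data over the GENUINE connected base `B^temp(Π^tp_X)⁰` (`ofConnectedTemperoidData`) -/

section ConnectedTemperoid

variable {K : Type u₀} [Field K] {X : SemiGraphs.TemperedArithmeticGroup.{u₀} K} {D₀ : Type u₀} [Category.{v₀} D₀]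
  {V : FrdIMonoidStub.{w}} {T₀ : RealifiedDivisorMonoids (D₀ := D₀) V}
  {VD : FrdICatStub.{u₀ + 1, u₀, w} (ConnectedPart (BTemp X.Pi))}
  {tf : TemperedFrobenioid T₀ (ConnectedPart (BTemp X.Pi)) VD} {hZ : tf.monoidType = MonoidType.Z}
  {hP : ∀ A : (ConnectedPart (BTemp X.Pi))ᵒᵖ, IsPerfect (tf.Φ.carrier A)}
  {NH : Subgroup (Field.absoluteGaloisGroup K) → tf.category → ℕ+ → Prop} {A₀ : tf.category}
  {hA₀ : PreFrobenioid.IsFrobeniusTrivial tf.toElem A₀} {hA₀' : SemiGraphs.IsGaloisObj A₀.base.obj}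
  {pullFrac : ∀ {A A' : (BiKummerSetting.mkOfConnectedTemperoid X tf hZ hP NH A₀ hA₀ hA₀').C} (_ : A' ⟶ A),
    (BiKummerSetting.mkOfConnectedTemperoid X tf hZ hP NH A₀ hA₀ hA₀').biratUnits A →
      (BiKummerSetting.mkOfConnectedTemperoid X tf hZ hP NH A₀ hA₀ hA₀').biratUnits A'}
  {lv N : ℕ+} {T : ThetaEnvData.{max u₀ w} N}
  {θ : (BiKummerSetting.mkOfConnectedTemperoid X tf hZ hP NH A₀ hA₀ hA₀').biratUnits
    (BiKummerSetting.mkOfConnectedTemperoid X tf hZ hP NH A₀ hA₀ hA₀').Aodot}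
  {Bl : (BiKummerSetting.mkOfConnectedTemperoid X tf hZ hP NH A₀ hA₀ hA₀').C}
  {Pl : (BiKummerSetting.mkOfConnectedTemperoid X tf hZ hP NH A₀ hA₀ hA₀').FractionPair θ Bl}
  {Rl : (BiKummerSetting.mkOfConnectedTemperoid X tf hZ hP NH A₀ hA₀ hA₀').NthRoot θ Pl lv pullFrac}
  (h : ModelFrobenioid.Hypotheses tf.divisorMonoid tf.ratFnFunctor)
  (Q : FrobenioidTheta.ThetaSubquotientStub.{w} (ConnectedPart (BTemp X.Pi))) (odd_l : Odd (lv : ℕ))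
  (R : (BiKummerSetting.mkOfConnectedTemperoid X tf hZ hP NH A₀ hA₀ hA₀').NthRoot Rl.root Rl.pair N pullFrac)
  (ιX : T.PiX ≃ₜ* X.Pi) (K' : Type w) [Field K'] (constEmb : K'ˣ →* tf.biratUnitsModel R.BN)
  (constEmb_injective : Function.Injective constEmb)
  (hinvc : ∀ g : Aut R.AN.base,
    pull tf.divisorMonoid g.hom (ModelFrobenioid.div R.pair.num) = ModelFrobenioid.div R.pair.num)
  (hinvp : ∀ y : T.PiX, y ∈ T.PiYdd →
    pull tf.divisorMonoid ((BiKummerSetting.mkOfConnectedTemperoid X tf hZ hP NH A₀ hA₀ hA₀').galoisSurj R.AN.base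
      R.αData.isGalois (ιX y)).hom (ModelFrobenioid.div R.pair.den) = ModelFrobenioid.div R.pair.den)

/-- **[EtTh] Prop. 5.2 (ii) at the §1-defining reading over the GENUINE connected base `B^temp(Π^tp_X)⁰`, UNCONDITIONAL**
(`s^trv_N = strvOfBiKummerData h R` constructed, `(s^⊓_N, s^⊔_N) = (R.pair.num, R.pair.den)`): the actions of `H_{B_N}` on `B_N` compatible
with the morphisms `s^⊓_N`, `s^⊔_N` determined by `s_{l·N}`, `τ_{l·N}` — the actions of Prop. 1.1 (ii) / Lem. 1.2 read in `C` — EXIST, are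
UNIQUE, and ARE "the actions determined by the bi-Kummer `l·N`-th root [cf. Proposition 4.3, (i)]" of the genuine §5 data.  No named
fact, no GAP-LEDGER row, no binder beyond the constructor data.
[cite: MochizukiEtTh2009, Prop 5.2 (ii) p.324 (PDF p.98); §5 p.331 (PDF p.105)] -/
theorem thetaPairActionsAgree_sectionDefined_ofConnectedTemperoidData :
    ∃ actS actT : (ofConnectedTemperoidData h Q odd_l R ιX K' constEmb constEmb_injective hinvc hinvp).HB →*
        Aut (ofConnectedTemperoidData h Q odd_l R ιX K' constEmb constEmb_injective hinvc hinvp).BN,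
      ((∀ hh : (ofConnectedTemperoidData h Q odd_l R ιX K' constEmb constEmb_injective hinvc hinvp).HB,
          (ofConnectedTemperoidData h Q odd_l R ιX K' constEmb constEmb_injective hinvc hinvp).sCap ≫ (actS hh).hom =
            ((ofConnectedTemperoidData h Q odd_l R ιX K' constEmb constEmb_injective hinvc hinvp).strv
              ((ofConnectedTemperoidData h Q odd_l R ιX K' constEmb constEmb_injective hinvc hinvp).autBaseIsoAB.symm
                (hh : Aut ((ofConnectedTemperoidData h Q odd_l R ιX K' constEmb constEmb_injective hinvc hinvp).base.obj
                  (ofConnectedTemperoidData h Q odd_l R ιX K' constEmb constEmb_injective hinvc hinvp).BN)))).hom ≫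
              (ofConnectedTemperoidData h Q odd_l R ιX K' constEmb constEmb_injective hinvc hinvp).sCap) ∧
        ∀ hh : (ofConnectedTemperoidData h Q odd_l R ιX K' constEmb constEmb_injective hinvc hinvp).HB,
          (ofConnectedTemperoidData h Q odd_l R ιX K' constEmb constEmb_injective hinvc hinvp).sCup ≫ (actT hh).hom =
            ((ofConnectedTemperoidData h Q odd_l R ιX K' constEmb constEmb_injective hinvc hinvp).strv
              ((ofConnectedTemperoidData h Q odd_l R ιX K' constEmb constEmb_injective hinvc hinvp).autBaseIsoAB.symm
                (hh : Aut ((ofConnectedTemperoidData h Q odd_l R ιX K' constEmb constEmb_injective hinvc hinvp).base.obj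
                  (ofConnectedTemperoidData h Q odd_l R ιX K' constEmb constEmb_injective hinvc hinvp).BN)))).hom ≫
              (ofConnectedTemperoidData h Q odd_l R ιX K' constEmb constEmb_injective hinvc hinvp).sCup) ∧
      (∀ actS' actT' : (ofConnectedTemperoidData h Q odd_l R ιX K' constEmb constEmb_injective hinvc hinvp).HB →*
          Aut (ofConnectedTemperoidData h Q odd_l R ιX K' constEmb constEmb_injective hinvc hinvp).BN,
        (∀ hh : (ofConnectedTemperoidData h Q odd_l R ιX K' constEmb constEmb_injective hinvc hinvp).HB,
          (ofConnectedTemperoidData h Q odd_l R ιX K' constEmb constEmb_injective hinvc hinvp).sCap ≫ (actS' hh).hom =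
            ((ofConnectedTemperoidData h Q odd_l R ιX K' constEmb constEmb_injective hinvc hinvp).strv
              ((ofConnectedTemperoidData h Q odd_l R ιX K' constEmb constEmb_injective hinvc hinvp).autBaseIsoAB.symm
                (hh : Aut ((ofConnectedTemperoidData h Q odd_l R ιX K' constEmb constEmb_injective hinvc hinvp).base.obj
                  (ofConnectedTemperoidData h Q odd_l R ιX K' constEmb constEmb_injective hinvc hinvp).BN)))).hom ≫
              (ofConnectedTemperoidData h Q odd_l R ιX K' constEmb constEmb_injective hinvc hinvp).sCap) →
        (∀ hh : (ofConnectedTemperoidData h Q odd_l R ιX K' constEmb constEmb_injective hinvc hinvp).HB,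
          (ofConnectedTemperoidData h Q odd_l R ιX K' constEmb constEmb_injective hinvc hinvp).sCup ≫ (actT' hh).hom =
            ((ofConnectedTemperoidData h Q odd_l R ιX K' constEmb constEmb_injective hinvc hinvp).strv
              ((ofConnectedTemperoidData h Q odd_l R ιX K' constEmb constEmb_injective hinvc hinvp).autBaseIsoAB.symm
                (hh : Aut ((ofConnectedTemperoidData h Q odd_l R ιX K' constEmb constEmb_injective hinvc hinvp).base.obj
                  (ofConnectedTemperoidData h Q odd_l R ιX K' constEmb constEmb_injective hinvc hinvp).BN)))).hom ≫
              (ofConnectedTemperoidData h Q odd_l R ιX K' constEmb constEmb_injective hinvc hinvp).sCup) →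
          actS' = actS ∧ actT' = actT) ∧
      ThetaPairActionsAgree (ofConnectedTemperoidData h Q odd_l R ιX K' constEmb constEmb_injective hinvc hinvp) actS actT :=
  thetaPairActionsAgree_sectionDefined_of_totallyEpi _ (epi_of_model (DivB := tf.divBNatTrans) h)
    (sgpCapSpec_ofConnectedTemperoidData h Q odd_l R ιX K' constEmb constEmb_injective hinvc hinvp)
    (sgpCupSpec_ofConnectedTemperoidData h Q odd_l R ιX K' constEmb constEmb_injective hinvc hinvp)

end ConnectedTemperoid

/-! ### The §5 data OF THE §1 SETTING (`ofThetaSettingData`; any Frobenius-trivial Galois `A_⊙`, in particular `A_⊙^bs := Ÿ̲̲`) -/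

section OfThetaSettingData

variable {p : ℕ} [Fact p.Prime] {D : ThetaSetting p} {E : D.EtaleThetaData} {l : ℕ} {C : E.DoubleUnderline l}
  {e : D.toTemperedCurve.GroupLevelData} {N : ℕ+} (μ : D.CyclotomeMod l N) (hC : D.Compat) (hS : D.Sec2Hyps)
  {D₀ : Type} [Category.{v₀} D₀] {V : FrdIMonoidStub.{0}} {T₀ : RealifiedDivisorMonoids (D₀ := D₀) V}
  {VD : FrdICatStub.{1, 0, 0} (ConnectedPart (BTemp (C.temperedArithmeticGroup e).Pi))}
  {tf : TemperedFrobenioid T₀ (ConnectedPart (BTemp (C.temperedArithmeticGroup e).Pi)) VD} {hZ : tf.monoidType = MonoidType.Z}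
  {hP : ∀ A : (ConnectedPart (BTemp (C.temperedArithmeticGroup e).Pi))ᵒᵖ, IsPerfect (tf.Φ.carrier A)}
  {NH : Subgroup (Field.absoluteGaloisGroup D.K) → tf.category → ℕ+ → Prop} {A₀ : tf.category}
  {hA₀ : PreFrobenioid.IsFrobeniusTrivial tf.toElem A₀} {hA₀' : SemiGraphs.IsGaloisObj A₀.base.obj}
  {pullFrac : ∀ {A A' : (BiKummerSetting.mkOfConnectedTemperoid (C.temperedArithmeticGroup e) tf hZ hP NH A₀ hA₀ hA₀').C} (_ : A' ⟶ A),
    (BiKummerSetting.mkOfConnectedTemperoid (C.temperedArithmeticGroup e) tf hZ hP NH A₀ hA₀ hA₀').biratUnits A →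
      (BiKummerSetting.mkOfConnectedTemperoid (C.temperedArithmeticGroup e) tf hZ hP NH A₀ hA₀ hA₀').biratUnits A'}
  {θ : (BiKummerSetting.mkOfConnectedTemperoid (C.temperedArithmeticGroup e) tf hZ hP NH A₀ hA₀ hA₀').biratUnits
    (BiKummerSetting.mkOfConnectedTemperoid (C.temperedArithmeticGroup e) tf hZ hP NH A₀ hA₀ hA₀').Aodot}
  {Bl : (BiKummerSetting.mkOfConnectedTemperoid (C.temperedArithmeticGroup e) tf hZ hP NH A₀ hA₀ hA₀').C}
  {Pl : (BiKummerSetting.mkOfConnectedTemperoid (C.temperedArithmeticGroup e) tf hZ hP NH A₀ hA₀ hA₀').FractionPair θ Bl}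
  {Rl : (BiKummerSetting.mkOfConnectedTemperoid (C.temperedArithmeticGroup e) tf hZ hP NH A₀ hA₀ hA₀').NthRoot θ Pl C.lPNat pullFrac}
  (h : ModelFrobenioid.Hypotheses tf.divisorMonoid tf.ratFnFunctor)
  (Q : FrobenioidTheta.ThetaSubquotientStub.{0} (ConnectedPart (BTemp (C.temperedArithmeticGroup e).Pi)))
  (R : (BiKummerSetting.mkOfConnectedTemperoid (C.temperedArithmeticGroup e) tf hZ hP NH A₀ hA₀ hA₀').NthRoot Rl.root Rl.pair N pullFrac)
  (K' : Type) [Field K'] (constEmb : K'ˣ →* tf.biratUnitsModel R.BN) (constEmb_injective : Function.Injective constEmb)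
  (hinvc : ∀ g : Aut R.AN.base,
    pull tf.divisorMonoid g.hom (ModelFrobenioid.div R.pair.num) = ModelFrobenioid.div R.pair.num)
  (hinvp : ∀ y : (C.thetaEnvData μ hC hS).PiX, y ∈ (C.thetaEnvData μ hC hS).PiYdd →
    pull tf.divisorMonoid ((BiKummerSetting.mkOfConnectedTemperoid (C.temperedArithmeticGroup e) tf hZ hP NH A₀ hA₀ hA₀').galoisSurj
      R.AN.base R.αData.isGalois ((ContinuousMulEquiv.refl _) y)).hom (ModelFrobenioid.div R.pair.den) = ModelFrobenioid.div R.pair.den)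

/-- **[EtTh] Prop. 5.2 (ii) at the §1-defining reading at the §5 data OF THE §1 SETTING, UNCONDITIONAL** (`X := Π^tp_X̲̲ = C.Huu`,
`T := C.thetaEnvData μ hC hS`, `ιX := id`; base `B^temp(Π^tp_X̲̲)⁰`; ANY Frobenius-trivial Galois `A_⊙` — in particular `A_⊙^bs := Ÿ̲̲`,
`BiKummerSetting.mkOfThetaSettingYdd`, since no `hH` is needed for (ii)): the actions of `H_{B_N}` on `B_N` compatible with `s^⊓_N`, `s^⊔_N`
— Prop. 1.1 (ii) / Lem. 1.2 OF THIS SETTING read in `C` — EXIST, are UNIQUE, and ARE the bi-Kummer actions.  Hypothesis list = the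
construction data (`tf`, `h`, `Q`, `Rl`/`R`, `constEmb`, `hinvc`/`hinvp`; Setting side `e`, `hC`, `hS`, `μ`); no FACT-LIST name.
[cite: MochizukiEtTh2009, Prop 5.2 (ii) p.324 (PDF p.98); §5 p.322 (PDF p.96); §5 p.331 (PDF p.105)] -/
theorem thetaPairActionsAgree_sectionDefined_ofThetaSettingData :
    ∃ actS actT : (ofThetaSettingData μ hC hS h Q R K' constEmb constEmb_injective hinvc hinvp).HB →*
        Aut (ofThetaSettingData μ hC hS h Q R K' constEmb constEmb_injective hinvc hinvp).BN,
      ((∀ hh : (ofThetaSettingData μ hC hS h Q R K' constEmb constEmb_injective hinvc hinvp).HB,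
          (ofThetaSettingData μ hC hS h Q R K' constEmb constEmb_injective hinvc hinvp).sCap ≫ (actS hh).hom =
            ((ofThetaSettingData μ hC hS h Q R K' constEmb constEmb_injective hinvc hinvp).strv
              ((ofThetaSettingData μ hC hS h Q R K' constEmb constEmb_injective hinvc hinvp).autBaseIsoAB.symm
                (hh : Aut ((ofThetaSettingData μ hC hS h Q R K' constEmb constEmb_injective hinvc hinvp).base.obj
                  (ofThetaSettingData μ hC hS h Q R K' constEmb constEmb_injective hinvc hinvp).BN)))).hom ≫
              (ofThetaSettingData μ hC hS h Q R K' constEmb constEmb_injective hinvc hinvp).sCap) ∧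
        ∀ hh : (ofThetaSettingData μ hC hS h Q R K' constEmb constEmb_injective hinvc hinvp).HB,
          (ofThetaSettingData μ hC hS h Q R K' constEmb constEmb_injective hinvc hinvp).sCup ≫ (actT hh).hom =
            ((ofThetaSettingData μ hC hS h Q R K' constEmb constEmb_injective hinvc hinvp).strv
              ((ofThetaSettingData μ hC hS h Q R K' constEmb constEmb_injective hinvc hinvp).autBaseIsoAB.symm
                (hh : Aut ((ofThetaSettingData μ hC hS h Q R K' constEmb constEmb_injective hinvc hinvp).base.obj
                  (ofThetaSettingData μ hC hS h Q R K' constEmb constEmb_injective hinvc hinvp).BN)))).hom ≫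
              (ofThetaSettingData μ hC hS h Q R K' constEmb constEmb_injective hinvc hinvp).sCup) ∧
      (∀ actS' actT' : (ofThetaSettingData μ hC hS h Q R K' constEmb constEmb_injective hinvc hinvp).HB →*
          Aut (ofThetaSettingData μ hC hS h Q R K' constEmb constEmb_injective hinvc hinvp).BN,
        (∀ hh : (ofThetaSettingData μ hC hS h Q R K' constEmb constEmb_injective hinvc hinvp).HB,
          (ofThetaSettingData μ hC hS h Q R K' constEmb constEmb_injective hinvc hinvp).sCap ≫ (actS' hh).hom =
            ((ofThetaSettingData μ hC hS h Q R K' constEmb constEmb_injective hinvc hinvp).strv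
              ((ofThetaSettingData μ hC hS h Q R K' constEmb constEmb_injective hinvc hinvp).autBaseIsoAB.symm
                (hh : Aut ((ofThetaSettingData μ hC hS h Q R K' constEmb constEmb_injective hinvc hinvp).base.obj
                  (ofThetaSettingData μ hC hS h Q R K' constEmb constEmb_injective hinvc hinvp).BN)))).hom ≫
              (ofThetaSettingData μ hC hS h Q R K' constEmb constEmb_injective hinvc hinvp).sCap) →
        (∀ hh : (ofThetaSettingData μ hC hS h Q R K' constEmb constEmb_injective hinvc hinvp).HB,
          (ofThetaSettingData μ hC hS h Q R K' constEmb constEmb_injective hinvc hinvp).sCup ≫ (actT' hh).hom =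
            ((ofThetaSettingData μ hC hS h Q R K' constEmb constEmb_injective hinvc hinvp).strv
              ((ofThetaSettingData μ hC hS h Q R K' constEmb constEmb_injective hinvc hinvp).autBaseIsoAB.symm
                (hh : Aut ((ofThetaSettingData μ hC hS h Q R K' constEmb constEmb_injective hinvc hinvp).base.obj
                  (ofThetaSettingData μ hC hS h Q R K' constEmb constEmb_injective hinvc hinvp).BN)))).hom ≫
              (ofThetaSettingData μ hC hS h Q R K' constEmb constEmb_injective hinvc hinvp).sCup) →
          actS' = actS ∧ actT' = actT) ∧
      ThetaPairActionsAgree (ofThetaSettingData μ hC hS h Q R K' constEmb constEmb_injective hinvc hinvp) actS actT :=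
  thetaPairActionsAgree_sectionDefined_ofConnectedTemperoidData (T := C.thetaEnvData μ hC hS) h Q C.odd_lPNat R
    (ContinuousMulEquiv.refl _) K' constEmb constEmb_injective hinvc hinvp

/-- **[EtTh] Prop. 5.2 (ii) at the §1-defining reading at the binder-census object of record `ofThetaSettingDataQ`** (the §5 data of the
Setting with `(l·Δ_Θ)_(−)` PINNED to abc-iut-L2-t9's `ThetaSubquotient.ofSettingSub`), UNCONDITIONAL: the section-defined actions EXIST,
are UNIQUE, and ARE the bi-Kummer actions.  [cite: MochizukiEtTh2009, Prop 5.2 (ii) p.324 (PDF p.98); §5 p.327 (PDF p.101); §5 p.331 (PDF p.105)] -/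
theorem thetaPairActionsAgree_sectionDefined_ofThetaSettingDataQ :
    ∃ actS actT : (ofThetaSettingDataQ μ hC hS h R K' constEmb constEmb_injective hinvc hinvp).HB →*
        Aut (ofThetaSettingDataQ μ hC hS h R K' constEmb constEmb_injective hinvc hinvp).BN,
      ((∀ hh : (ofThetaSettingDataQ μ hC hS h R K' constEmb constEmb_injective hinvc hinvp).HB,
          (ofThetaSettingDataQ μ hC hS h R K' constEmb constEmb_injective hinvc hinvp).sCap ≫ (actS hh).hom =
            ((ofThetaSettingDataQ μ hC hS h R K' constEmb constEmb_injective hinvc hinvp).strv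
              ((ofThetaSettingDataQ μ hC hS h R K' constEmb constEmb_injective hinvc hinvp).autBaseIsoAB.symm
                (hh : Aut ((ofThetaSettingDataQ μ hC hS h R K' constEmb constEmb_injective hinvc hinvp).base.obj
                  (ofThetaSettingDataQ μ hC hS h R K' constEmb constEmb_injective hinvc hinvp).BN)))).hom ≫
              (ofThetaSettingDataQ μ hC hS h R K' constEmb constEmb_injective hinvc hinvp).sCap) ∧
        ∀ hh : (ofThetaSettingDataQ μ hC hS h R K' constEmb constEmb_injective hinvc hinvp).HB,
          (ofThetaSettingDataQ μ hC hS h R K' constEmb constEmb_injective hinvc hinvp).sCup ≫ (actT hh).hom =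
            ((ofThetaSettingDataQ μ hC hS h R K' constEmb constEmb_injective hinvc hinvp).strv
              ((ofThetaSettingDataQ μ hC hS h R K' constEmb constEmb_injective hinvc hinvp).autBaseIsoAB.symm
                (hh : Aut ((ofThetaSettingDataQ μ hC hS h R K' constEmb constEmb_injective hinvc hinvp).base.obj
                  (ofThetaSettingDataQ μ hC hS h R K' constEmb constEmb_injective hinvc hinvp).BN)))).hom ≫
              (ofThetaSettingDataQ μ hC hS h R K' constEmb constEmb_injective hinvc hinvp).sCup) ∧
      (∀ actS' actT' : (ofThetaSettingDataQ μ hC hS h R K' constEmb constEmb_injective hinvc hinvp).HB →*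
          Aut (ofThetaSettingDataQ μ hC hS h R K' constEmb constEmb_injective hinvc hinvp).BN,
        (∀ hh : (ofThetaSettingDataQ μ hC hS h R K' constEmb constEmb_injective hinvc hinvp).HB,
          (ofThetaSettingDataQ μ hC hS h R K' constEmb constEmb_injective hinvc hinvp).sCap ≫ (actS' hh).hom =
            ((ofThetaSettingDataQ μ hC hS h R K' constEmb constEmb_injective hinvc hinvp).strv
              ((ofThetaSettingDataQ μ hC hS h R K' constEmb constEmb_injective hinvc hinvp).autBaseIsoAB.symm
                (hh : Aut ((ofThetaSettingDataQ μ hC hS h R K' constEmb constEmb_injective hinvc hinvp).base.obj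
                  (ofThetaSettingDataQ μ hC hS h R K' constEmb constEmb_injective hinvc hinvp).BN)))).hom ≫
              (ofThetaSettingDataQ μ hC hS h R K' constEmb constEmb_injective hinvc hinvp).sCap) →
        (∀ hh : (ofThetaSettingDataQ μ hC hS h R K' constEmb constEmb_injective hinvc hinvp).HB,
          (ofThetaSettingDataQ μ hC hS h R K' constEmb constEmb_injective hinvc hinvp).sCup ≫ (actT' hh).hom =
            ((ofThetaSettingDataQ μ hC hS h R K' constEmb constEmb_injective hinvc hinvp).strv
              ((ofThetaSettingDataQ μ hC hS h R K' constEmb constEmb_injective hinvc hinvp).autBaseIsoAB.symm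
                (hh : Aut ((ofThetaSettingDataQ μ hC hS h R K' constEmb constEmb_injective hinvc hinvp).base.obj
                  (ofThetaSettingDataQ μ hC hS h R K' constEmb constEmb_injective hinvc hinvp).BN)))).hom ≫
              (ofThetaSettingDataQ μ hC hS h R K' constEmb constEmb_injective hinvc hinvp).sCup) →
          actS' = actS ∧ actT' = actT) ∧
      ThetaPairActionsAgree (ofThetaSettingDataQ μ hC hS h R K' constEmb constEmb_injective hinvc hinvp) actS actT :=
  thetaPairActionsAgree_sectionDefined_ofThetaSettingData μ hC hS h (ThetaSubquotient.ofSettingSub D l C.Huu) R K' constEmb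
    constEmb_injective hinvc hinvp

end OfThetaSettingData

end ThetaFrobenioid

end Literature.AnabelianGeometry.EtaleTheta

end
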